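import Summits.BirchSwinnertonDyer.BirchSwinnertonDyer.Theorems.SignedLowerHalvesSmallImageLowerHalfBothSignsRttJunctionShaSp2Injective
import Summits.BirchSwinnertonDyer.BirchSwinnertonDyer.Theorems.SignedLowerHalvesSmallImageLowerHalfBothSignsRttCharRoadE2JunctionJ2Closed
import HarnessLib

/-!
# Route `SignedLowerHalves`, crux L `SmallImageLowerHalfBothSigns` (stmt-BirchSwinnertonDyer-23599), line `rtt_w3` v29 — row **S3α** (`stub_junctionSha_ns`):
# ★★★ BRICK α1 IN THE FRAME'S CURRENCY — `sp² : 𝐇²₂ ⧸ T₂ ↪ 𝐇²_cyc` EXISTS AND IS INJECTIVE for a generator pair up to units and `𝔣 ≠ 0`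

INPUTS hand `bsd-inputs-honda-p1` g27 under LEAD `cruxlead-stmt-BirchSwinnertonDyer-23599` g13 (DESIGN `Lines/rtt_w3-DESIGN-S3alpha-lead-g13.md`, brick α1 «∃ e :
QuotSMulTop (C (X − C 0)) D₂'.H →ₗ[Λ_𝒪] I₂.H, Injective e»). Helper `--supports stmt-BirchSwinnertonDyer-23599`. THEOREMS ONLY; no named fact, no `sorry`.
This file only DISCHARGES the tower hypotheses of `SmallImageRttJunctionSha.exists_injective_specialisationLinearMap₂_frame_zero_of_finite` from the frame exactly as LEAD g12's
`SmallImageRttCharRoadJ2.junction_J2_of_hreg` does for row J2: `γ₂ ∈ ker κ₁` and `κ₂ γ₂ ∈ ℤ_pˣ` from the generator-pair hypothesis `hγ` (`of_isTopGeneratorPair_unitTwist`),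
`N_{p𝔣} ≤ Gal(K̄/K̃_m)` (cf2 `ramificationSubgroup_suppPF_le_pairLayerSubgroup`), `supp(p𝔣)` finite from `𝔣 ≠ ⊥`, the corestriction `sp²` from `exists_coresHom₂`, and the
`Λ_𝒪`-structure on `QuotSMulTop (C (X − C 0)) D₂'.H` = the line file's `Module.compHom _ (PowerSeries.map C)` (so `hιH` is `rfl`).
* ★★★ `junctionSha_alpha1` — `∃ e : QuotSMulTop (C (X − C 0)) D₂'.H →ₗ[Λ_𝒪] I₂.H, Function.Injective e ∧ ∀ n k y, I₂.proj n k (e [y]) = cor_{K̃_n/K^{(1)}_n} (D₂'.proj n k y)`.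
What it is NOT: the row S3α (`λ(𝐇²₂/T₂) ≤ JunctionLamY`) still needs bricks α2–α5 (`I₂.H` f.g./torsion and its λ against the Poitou–Tate side; -w3 lineage).
HONEST FRAMING: S3α, S3β, S4′, E2, crux L, crux M and BSD remain OPEN; BSD is proved for NO curve.

References: [JohnsonLeungKings2011] §4.2 Def. 4.2 (94), Lemma 4.4, Cor. 5.3; [PerrinRiou1994Invent] §1.3; [NeukirchSchmidtWingberg2008] I §5 (1.5.3)–(1.5.7), (8.3.20);
[Washington1997] §13.2.
-/

set_option autoImplicit false
-- the Theorems namespace of this sub repeats the summit name by design (D-0017 nested layout)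
set_option linter.dupNamespace false

noncomputable section

open scoped NumberField
open Field IsDedekindDomain
open Literature.NumberTheory.GaloisRepresentations
open Literature.NumberTheory.EllipticCurves
open Literature.NumberTheory.ComplexMultiplication.EllipticUnits (IwasawaAlgebraO₂)
open Literature.NumberTheory.ComplexMultiplication.EllipticUnits.JohnsonLeungKings2011
open Summit.BirchSwinnertonDyer.BirchSwinnertonDyer.Theorems.SmallImageRttD2J1
open Summit.BirchSwinnertonDyer.BirchSwinnertonDyer.Theorems.SmallImageRttD2J2

namespace Summit.BirchSwinnertonDyer.BirchSwinnertonDyer.Theorems.SmallImageRttJunctionSha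

variable {K : Type} [Field K] [NumberField K] {p : ℕ} [Fact p.Prime] (S : Set (PadicAlgCl p)) [FiniteDimensional ℚ_[p] (padicCoeffField S)]
  (κ₁ κ₂ : ZpExtension K p) {γ₁ γ₂ : absoluteGaloisGroup K} (θ : absoluteGaloisGroup K →ₜ* (padicCoeffIntegers S)ˣ) (𝔣 : Ideal (𝓞 K))

/-- ★★★ **BRICK α1 of row S3α in the frame's currency**: for a generator pair up to units (`hγ`), `𝔣 ≠ 0`, any pinned two-variable datum `D₂'` in degree `2` and any pinned
cyclotomic datum `I₂` in degree `2`, the untwisted specialisation `e = sp² : 𝐇²₂ ⧸ (C (X − C 0)) →ₗ[Λ_𝒪] 𝐇²_cyc` EXISTS, is INJECTIVE, and is levelwise the corestriction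
`cor_{K̃_n/K^{(1)}_n}` — with the line file's `Λ_𝒪`-structure `Module.compHom _ (PowerSeries.map C)` on the quotient. No `cd_p ≤ 2` input.
[cite: JohnsonLeungKings2011, Cor. 5.3 (arXiv p0015:L1–20)] [cite: PerrinRiou1994Invent, §1.3] [cite: NeukirchSchmidtWingberg2008, (8.3.20)] -/
theorem junctionSha_alpha1 (hγ : ∃ u₁ u₂ : ℤ_[p]ˣ, ZpExtension.IsTopGeneratorPair (κ₁.unitTwist u₁) (κ₂.unitTwist u₂) γ₁ γ₂) (h𝔣 : 𝔣 ≠ ⊥)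
    (D₂' : IwasawaCohomologyDataO S κ₁ κ₂ γ₁ γ₂ θ 𝔣 2) (I₂ : CycIwasawaCohomologyDataO S κ₁ γ₁ θ (suppPF p 𝔣) 2) :
    letI : Module (IwasawaAlgebraO S) (QuotSMulTop (PowerSeries.C (PowerSeries.X - PowerSeries.C (0 : padicCoeffIntegers S)) : IwasawaAlgebraO₂ S) D₂'.H) :=
      Module.compHom _ (PowerSeries.map (PowerSeries.C : padicCoeffIntegers S →+* IwasawaAlgebraO S))
    ∃ e : QuotSMulTop (PowerSeries.C (PowerSeries.X - PowerSeries.C (0 : padicCoeffIntegers S)) : IwasawaAlgebraO₂ S) D₂'.H →ₗ[IwasawaAlgebraO S] I₂.H,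
      Function.Injective e ∧ ∀ (n k : ℕ) (y : D₂'.H), I₂.proj n k (e (Submodule.Quotient.mk y)) = spLevel S κ₁ κ₂ θ 𝔣 n k 2 (D₂'.proj n k y) := by
  letI : Module (IwasawaAlgebraO S) (QuotSMulTop (PowerSeries.C (PowerSeries.X - PowerSeries.C (0 : padicCoeffIntegers S)) : IwasawaAlgebraO₂ S) D₂'.H) :=
    Module.compHom _ (PowerSeries.map (PowerSeries.C : padicCoeffIntegers S →+* IwasawaAlgebraO S))
  obtain ⟨hγ₁, hγu⟩ := SmallImageRttD2J2Delta.of_isTopGeneratorPair_unitTwist κ₁ κ₂ hγ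
  have hV : ∀ m : ℕ, ramificationSubgroup K (suppPF p 𝔣) ≤ pairLayerSubgroup κ₁ κ₂ m :=
    fun m ↦ PrintCf2.JLKDescent.ramificationSubgroup_suppPF_le_pairLayerSubgroup κ₁ κ₂ 𝔣 m
  have hP : (suppPF p 𝔣).Finite := by
    refine Ideal.finite_factors (mul_ne_zero ?_ h𝔣)
    rw [Ne, Ideal.zero_eq_bot, Ideal.span_singleton_eq_bot]
    exact_mod_cast (Fact.out : p.Prime).ne_zero
  obtain ⟨res, hres⟩ := exists_coresHom₂ D₂' I₂
  obtain ⟨e, he, hemk⟩ := exists_injective_specialisationLinearMap₂_frame_zero_of_finite hγ₁ hγu hV hres hP (fun _ _ ↦ rfl)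
  exact ⟨e, he, fun n k y ↦ by rw [hemk, hres]⟩

end Summit.BirchSwinnertonDyer.BirchSwinnertonDyer.Theorems.SmallImageRttJunctionSha

end
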